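import Summits.Langlands.Langlands.Theses.PrimitiveRankLadder
import Literature.NumberTheory.GaloisRepresentations.AlgebraicHeckeCharacterGrossencharakterProofs
import Literature.NumberTheory.Automorphic.GLOneOfHeckeCharacterBJ
import Literature.NumberTheory.Automorphic.GLOneArchParameterOfAlgebraicCharacter
import HarnessLib

/-!
# R1 `PrimitiveRankLadder.RankOneAutomorphy` (stmt-Langlands-24805) ⟸ the Hecke-character dictionary (import-light core)

Support file (closes nothing) for the open SUPPORT leaf R1 = `RankOneAutomorphy` of the decomp-langlands
rank ladders (item stmt-Langlands-24805, shared verbatim by the routes PrimitiveRankLadder, EllipticDegreeLadder,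
TriangularRankLadder, ParityLadder, MonodromyDichotomy, DescentTypeTrichotomy, PolarisationCarving):
weak automorphy — a cuspidal L-algebraic `π` of `GL₁(𝔸_K)` Satake–Frobenius compatible with `ρ` at all but
finitely many places — of every irreducible, almost everywhere unramified `ρ : Γ_K →ₜ* GL₁(ℚ̄_ℓ)` which is
de Rham at every `v ∣ ℓ` for Fontaine's pinned datum.  decomp-langlands lens-5 gen 25 node (DAG edge).

## What is proved (0 sorry)

* `isLAlgebraic_glOne_of_isAlgebraic` — the Borel–Jacquet datum `π_θ = ℂ·(θ ∘ det)/⊥` of an ALGEBRAIC Hecke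
  character `θ` is L-algebraic (public copy of the private `isLAlgebraic_glOne_of_isAlgebraic_aux` of
  `OrdinaryPrimeTransportReciprocityUpToIrreducibilityRankOneRationalAutomorphyAway`).
* `exists_cuspidal_satakeFrobCompatible_of_heckeCharacter` — THE FIBRE KERNEL (unconditional): if an
  algebraic Hecke character `θ` of `K` carries the Frobenius dictionary of `ρ` almost everywhere
  (`θ`, `ρ` unramified and `char ρ(Frob_v) = X - ι⁻¹(θ(ϖ_v))⁻¹`), then `π_θ` is a cuspidal L-algebraic
  automorphic representation datum of `GL₁(𝔸_K)` with `SatakeFrobCompatibleAt ι π_θ ρ v` almost everywhere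
  (Satake parameter `{θ(ϖ_v)}` off a level of `θ`).
* `rankOneAutomorphy_fibre` — the `(K, ℓ, ι, ρ)`-fibre of R1 from the `(K, ℓ, ρ, ι)`-fibre of the fact
  (to make `ρ` weakly automorphic it suffices to produce ITS algebraic Hecke character).
* `rankOneAutomorphy_of_heckeCharacterFact (h) : PrimitiveRankLadder.RankOneAutomorphy` — R1 BY NAME from
  the TEXT of the catalogued named fact `FramedGaloisRep.exists_heckeCharacter_of_isDeRhamFramed` (module
  `Literature.NumberTheory.GaloisRepresentations.DeRhamLAdicCharacterHecke`; Patrikis 2019 Prop. 2.2.1 /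
  Serre 1968 Ch. III §2.3 Thm. 2 with App. A: a de Rham `ℓ`-adic character is the avatar of an algebraic
  Hecke character), taken VERBATIM as the hypothesis `h` so that this file does not import that module (import-light: PrimitiveRankLadder + three GL₁ / Hecke-character Literature modules):
  `rankOneAutomorphy_of_heckeCharacterFact that_fact` typechecks by `Iff.rfl`, and composed with the tree's
  reduction `FramedGaloisRep.exists_heckeCharacter_of_isDeRhamFramed_of_local hloc`
  (`DeRhamLAdicCharacterHeckeReduction`) R1 is ONE local input away: Tate's theorem that a de Rham rank-one
  character of a characteristic-`0` local field is locally algebraic (Serre III App. A6 Cor. 2; Conrad 2011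
  App. B Prop. B.4) — NOT proved in the tree (Sen's theorem: named facts `PAdicHodge.SenFiniteness`,
  `PAdicHodge.SenOperatorExistsUnique`; Hodge–Tate periods of Lubin–Tate characters).  The sibling file
  `PrimitiveRankLadderRankOneAutomorphyOfTateLocal` (imports this one + the reduction) states that composite
  (`rankOneAutomorphy_of_local`) with `hloc` as its only hypothesis.

The PROVED SECTOR of R1 is already in the tree and is NOT restated here (gate dedup): every `E`-rational
`ρ : Γ_K →ₜ* GL₁(ℚ̄_ℓ)` (Frobenius polynomials over a number field `E`) is weakly automorphic UNCONDITIONALLY —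
`ReciprocityUpToIrreducibility.rankOne_weakAutomorphy_of_isRationalOver`
(`IrreducibilityBySelfDualityReciprocityUpToIrreducibilityRankOneRationalAutomorphy`; Böckle–Hui Thm. 1.1 =
`exists_heckeCharacter_of_weaklyDivides_holds`, a THEOREM of the tree).  What separates that sector from R1 is
"de Rham rank one ⟹ `E`-rational", i.e. again Tate's local theorem.

## References

* [Patrikis2019] S. Patrikis, *Variations on a theorem of Tate*, Mem. AMS 1238 (2019), Prop. 2.2.1.
* [SerreAbelianLadic1968] J.-P. Serre, *Abelian ℓ-adic representations and elliptic curves* (1968),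
  Ch. III §2.3 Thm. 2, App. A6 Cor. 2.
* [Conrad2011LiftingGlobal] B. Conrad, *Lifting global representations with local properties*, App. B,
  Def. B.1, Prop. B.4.
* [BorelJacquet1979] A. Borel, H. Jacquet, *Automorphic forms and automorphic representations*, Corvallis
  1979, 4.6.
* [BuzzardGeeLMS2014] K. Buzzard, T. Gee, *The conjectural connections between automorphic
  representations and Galois representations*, Def. 3.1.1, Conj. 3.2.1 (n = 1).
-/

set_option linter.dupNamespace false

noncomputable section

open scoped NumberField Classical Polynomial MatrixGroups Matrix
open Filter IsDedekindDomain Field Polynomial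
open Literature.NumberTheory.Automorphic Literature.NumberTheory.GaloisRepresentations
open Literature.NumberTheory.PAdicHodge
open Summit.Langlands

namespace Summit.Langlands.Langlands.Theorems.PrimitiveRankLadderRankOneAutomorphyOfHeckeDictionary

variable {K : Type} [Field K] [NumberField K] {ℓ : ℕ} [Fact ℓ.Prime]

/-! ### 1. The Borel–Jacquet datum of an algebraic Hecke character is L-algebraic -/

/-- **`π_θ` is L-algebraic for `θ` algebraic.**  An algebraic Hecke character has an infinity type
`(p, q)` (`HeckeCharacter.isAlgebraic_iff_exists_hasInfinityType`); an automorphic representation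
datum of `GL₁(𝔸_K)` on which `GL₁(𝔸_K)` acts through `θ ∘ det` has the infinity type
`σ ↦ {(-n_σ, -n_σ̄)}` (`AutomorphicRepData.exists_hasInfinityType_of_hasInfinityType_heckeCharacter_glOne`),
whose exponents are integers.  (Public copy of the private
`ReciprocityUpToIrreducibility.isLAlgebraic_glOne_of_isAlgebraic_aux`.) [cite: BuzzardGeeLMS2014, Def. 3.1.1]
[cite: Clozel1990, §1.1 and §3.3 (n = 1)] -/
theorem isLAlgebraic_glOne_of_isAlgebraic {hcpt : isCompact_glFiniteIntegralLevel 1 K}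
    {θ : HeckeCharacter K} (hθ : θ.IsAlgebraic) (τ : AutomorphicRepData (AutomorphyDatum.gl 1 K hcpt))
    (hact : ∀ (g : (AdelicGroupData.gl 1 K).Adelic), ∀ φ ∈ τ.W,
      rightTranslation (AdelicGroupData.gl 1 K) g φ -
        ((θ (Matrix.GeneralLinearGroup.det g) : ℂˣ) : ℂ) • φ ∈ τ.W') :
    τ.IsLAlgebraic := by
  classical
  obtain ⟨p, q, hpq⟩ := (θ.isAlgebraic_iff_exists_hasInfinityType).mp hθ
  obtain ⟨T, hT, hTa⟩ := τ.exists_hasInfinityType_of_hasInfinityType_heckeCharacter_glOne hact hpq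
  refine ⟨T, hT, fun σ w hw => ?_⟩
  have hwa : w.a = -((HeckeCharacter.embExponent p q σ : ℤ) : ℂ) := by
    have hmem : w.a ∈ (T σ).map ArchWeight.a := Multiset.mem_map_of_mem _ hw
    rw [hTa σ] at hmem
    exact Multiset.mem_singleton.mp hmem
  obtain ⟨m, hm⟩ := w.exists_int_sub
  refine ⟨-HeckeCharacter.embExponent p q σ, -HeckeCharacter.embExponent p q σ - m, ?_, ?_⟩
  · rw [hwa]
    push_cast
    ring
  · have hb : w.b = w.a - m := by rw [← hm]; ring
    rw [hb, hwa]
    push_cast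
    ring

/-! ### 2. The fibre kernel: Hecke dictionary ⟹ cuspidal L-algebraic `π` Satake–Frobenius compatible a.e. -/

/-- **THE FIBRE KERNEL (unconditional).**  Let `ρ : Γ_K →ₜ* GL₁(ℚ̄_ℓ)` and let `θ` be an ALGEBRAIC Hecke
character of `K` such that at all but finitely many finite places `θ` and `ρ` are unramified and
`char ρ(Frob_v) = X - ι⁻¹(θ(ϖ_v))⁻¹` (the conclusion shape of the catalogued facts
`exists_heckeCharacter_of_weaklyDivides` / `FramedGaloisRep.exists_heckeCharacter_of_isDeRhamFramed`).
Then the Borel–Jacquet datum `π_θ = ℂ·(θ ∘ det)/⊥` (`exists_automorphicRepData_detTwist_glOne`) is a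
cuspidal (`isAutomorphicForm_detTwist_glOne`, no proper parabolics in rank one), L-algebraic
(`isLAlgebraic_glOne_of_isAlgebraic`) automorphic representation datum of `GL₁(𝔸_K)` whose Satake
parameter at every `v` prime to a level `𝔪` of `θ` is `{θ(ϖ_v)}` (`hasSatakeParamAt_detTwist_glOne`), and
`arithFrobPolyOfSatake ι q_v 1 {θ(ϖ_v)} = X - ι⁻¹(θ(ϖ_v))⁻¹` (`arithFrobPolyOfSatake_one`): so
`SatakeFrobCompatibleAt ι π_θ ρ v` at all but finitely many `v`. [cite: BorelJacquet1979, 4.6]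
[cite: BuzzardGeeLMS2014, Conj. 3.2.1 (n = 1)] -/
theorem exists_cuspidal_satakeFrobCompatible_of_heckeCharacter (hcpt : isCompact_glFiniteIntegralLevel 1 K)
    (ι : PadicAlgCl ℓ ≃+* ℂ) (ρ : FramedGaloisRep K (PadicAlgCl ℓ) 1) {θ : HeckeCharacter K}
    (hθalg : θ.IsAlgebraic)
    (hθ : ∀ᶠ v : HeightOneSpectrum (𝓞 K) in cofinite, θ.IsUnramifiedAt v ∧ ρ.IsUnramifiedAt v ∧
      ρ.HasFrobCharpolyAt v (X - C (ι.symm (θ.valueAtUniformizer v)⁻¹))) :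
    ∃ π : CuspidalAutomorphicRepData 1 K hcpt, π.1.IsLAlgebraic ∧
      ∀ᶠ v : HeightOneSpectrum (𝓞 K) in cofinite, SatakeFrobCompatibleAt ι π.1 ρ v := by
  classical
  -- the Borel–Jacquet datum `π_θ = ℂ·(θ ∘ det)/⊥`: cuspidal, Hecke character `θ`, L-algebraic
  obtain ⟨τ, hW, hW'⟩ := exists_automorphicRepData_detTwist_glOne hcpt θ
  have hcusp : τ.W ≤ cuspFormsGL 1 K hcpt := by
    rw [hW, Submodule.span_le]
    rintro _ rfl
    exact IsCuspFormGL.mem_cuspFormsGL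
      ⟨isAutomorphicForm_detTwist_glOne hcpt θ, fun k hk hk1 => absurd hk1 (by omega)⟩
  have hact : ∀ (g : (AdelicGroupData.gl 1 K).Adelic), ∀ φ ∈ τ.W,
      rightTranslation (AdelicGroupData.gl 1 K) g φ -
        ((θ (Matrix.GeneralLinearGroup.det g) : ℂˣ) : ℂ) • φ ∈ τ.W' := by
    intro g φ hφ
    rw [hW, Submodule.mem_span_singleton] at hφ
    obtain ⟨c, rfl⟩ := hφ
    rw [map_smul, rightTranslation_detTwist_glOne, detTwist_apply', smul_comm, sub_self]
    exact τ.W'.zero_mem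
  obtain ⟨𝔪, h𝔪, hθ𝔪⟩ := HeckeCharacter.exists_level_glOne θ
  refine ⟨⟨τ, hcusp⟩, isLAlgebraic_glOne_of_isAlgebraic hθalg τ hact, ?_⟩
  filter_upwards [hθ, (Ideal.finite_factors h𝔪).compl_mem_cofinite] with v hv hv𝔪
  -- the Satake parameter `{θ(ϖ_v)}` of `π_θ` at `v`
  have hsat : τ.HasSatakeParamAt v {θ.valueAtUniformizer v} := by
    have hs := AutomorphicRepData.hasSatakeParamAt_detTwist_glOne hcpt hW hW' h𝔪 hθ𝔪 v hv𝔪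
      (HeckeCharacter.valued_uniformizer (K := K) v)
    simpa only [HeckeCharacter.valueAtUniformizer, HeckeCharacter.localComponent_apply] using hs
  refine ⟨{θ.valueAtUniformizer v}, hsat, hv.2.1, ?_⟩
  rw [arithFrobPolyOfSatake_one, Multiset.map_singleton, Multiset.prod_singleton]
  exact hv.2.2

/-! ### 3. R1 by name, modulo the catalogued global fact taken as a verbatim hypothesis -/

/-- **The (K, ℓ, ι, ρ)-FIBRE of R1 from the (K, ℓ, ρ, ι)-fibre of the fact** (sharpest form: to make `ρ`
weakly automorphic it suffices to produce ITS algebraic Hecke character). [cite: Patrikis2019, Prop. 2.2.1] -/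
theorem rankOneAutomorphy_fibre (hcpt : isCompact_glFiniteIntegralLevel 1 K) (ι : PadicAlgCl ℓ ≃+* ℂ)
    (ρ : FramedGaloisRep K (PadicAlgCl ℓ) 1)
    (hfib : ∃ χ : HeckeCharacter K, χ.IsAlgebraic ∧
      ∀ᶠ v : HeightOneSpectrum (𝓞 K) in cofinite, χ.IsUnramifiedAt v ∧ ρ.IsUnramifiedAt v ∧
        ρ.HasFrobCharpolyAt v (X - C (ι.symm (χ.valueAtUniformizer v)⁻¹))) :
    ∃ π : CuspidalAutomorphicRepData 1 K hcpt, π.1.IsLAlgebraic ∧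
      ∀ᶠ v : HeightOneSpectrum (𝓞 K) in cofinite, SatakeFrobCompatibleAt ι π.1 ρ v := by
  obtain ⟨θ, hθalg, hθ⟩ := hfib
  exact exists_cuspidal_satakeFrobCompatible_of_heckeCharacter hcpt ι ρ hθalg hθ

/-- **R1 `PrimitiveRankLadder.RankOneAutomorphy` (stmt-Langlands-24805) from the text of the named fact
`FramedGaloisRep.exists_heckeCharacter_of_isDeRhamFramed`** (hypothesis `h` is that fact VERBATIM — module
`Literature.NumberTheory.GaloisRepresentations.DeRhamLAdicCharacterHecke`, so `h := that_fact_proof` by `Iff.rfl`;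
Patrikis 2019 Prop. 2.2.1; Serre III §2.3 Thm. 2 + App. A): the de Rham clause of the pinned-geometric
hypothesis feeds the fact, which returns an algebraic Hecke character with the Frobenius dictionary; the
fibre kernel does the rest (irreducibility and the unramified-a.e. clause are not used).
[cite: Patrikis2019, Prop. 2.2.1] [cite: SerreAbelianLadic1968, Ch. III §2.3 Thm. 2] -/
theorem rankOneAutomorphy_of_heckeCharacterFact
    (h : ∀ (K : Type) [Field K] [NumberField K] (ℓ : ℕ) [Fact ℓ.Prime]
      (ψ : FramedGaloisRep K (PadicAlgCl ℓ) 1),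
      (∀ (v : HeightOneSpectrum (𝓞 K)) (hv : ((ℓ : ℕ) : 𝓞 K) ∈ v.asIdeal),
        (Literature.NumberTheory.PAdicHodge.fontainePstAdicCompletion v ℓ hv).IsDeRhamFramed (ψ.toLocal v)) →
      ∀ (ι : PadicAlgCl ℓ ≃+* ℂ), ∃ χ : HeckeCharacter K, χ.IsAlgebraic ∧
        ∀ᶠ v : HeightOneSpectrum (𝓞 K) in cofinite, χ.IsUnramifiedAt v ∧ ψ.IsUnramifiedAt v ∧
          ψ.HasFrobCharpolyAt v (X - C (ι.symm (χ.valueAtUniformizer v)⁻¹))) :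
    Theses.PrimitiveRankLadder.RankOneAutomorphy := by
  intro K _ _ hcpt ℓ _ ι ρ _hirr hgeo
  exact rankOneAutomorphy_fibre hcpt ι ρ (h K ℓ ρ hgeo.2 ι)

end Summit.Langlands.Langlands.Theorems.PrimitiveRankLadderRankOneAutomorphyOfHeckeDictionary

end
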